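import Summits.Langlands.Langlands.Theorems.PicardMuOrdinaryMuOrdinaryFamilyRTThorneImageLinearDisjoint
import Summits.Langlands.Langlands.Theorems.PicardMuOrdinaryMuOrdinaryFamilyRTPointPlan
import Summits.Langlands.Langlands.Theorems.PicardMuOrdinaryMuOrdinaryFamilyRTCharZeroDefs
import HarnessLib

/-!
# PA-I glue H9 = G2d: the finite `D/F'` whose linear disjointness from `L` keeps the heart image
# along the tower `K ⊆ F' ⊆ L` (stub of `stub_thorneInputOverL`, line thorne-minimal-lift)

Crux `Summit.Langlands.Langlands.Theses.PicardMuOrdinary.MuOrdinaryFamilyRT`, line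
thorne-minimal-lift.  In the assembly of the Galois input over the soluble CM extension `L/F'`
(CHT 2008, Lemma 4.1.2: `L` can be chosen with `D ⊗_{F'} L` a field for any prescribed finite
`D/F'`) one needs a finite `D/F'` such that for every such `L` the residual heart representation
`r̄_f^B ∘ res_{K → F'} ∘ res_{F' → L}` of `Γ_L` has the same image as `r̄_f^B` on `Γ_K`, granted
that `r̄_f^B ∘ res_{K → F'}` already has that image.

`exists_disjointnessField_heart` (H9 = G2d): take `φ = r̄_f^B ∘ res_{K → F'} : Γ_{F'} → GL₃(𝔽₃)`;
its kernel is open (preimage under the continuous restriction `Γ_{F'} → Γ_K` of the open kernel of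
the heart, `FreeSeedSmoothRt.isOpen_ker_rbar` / `pointPlan_small`); `D = F̄'^{ker φ}` is finite over
`F'` (G2b, `finiteDimensional_fixedField_ker`), and for `L` with `D ⊗_{F'} L` a field G2
(`range_comp_absGaloisRestrict_eq_of_isField`) gives `(φ ∘ res_{F' → L})(Γ_L) = φ(Γ_{F'})`, which is
`r̄_f^B(Γ_K)` by hypothesis.

References: L. Clozel, M. Harris, R. Taylor, *Automorphy for some l-adic lifts of automorphic mod l
Galois representations*, Publ. Math. IHÉS 108 (2008), Lemma 4.1.2 and §4; J. Neukirch, *Algebraic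
Number Theory* (1999), Ch. IV §1.
-/

set_option linter.dupNamespace false -- `Summit.Langlands.Langlands.…` is the problem's namespace

namespace Summit.Langlands.Langlands.Cruxes.MuOrdinaryFamilyRT.ThorneMinimalLift

open scoped NumberField Polynomial Matrix Classical TensorProduct
open Field IsDedekindDomain Polynomial
open Literature.NumberTheory.GaloisRepresentations Literature.NumberTheory.Automorphic
open Summit.Langlands.Langlands.Cruxes.MuOrdinaryFamilyRT.CharZeroDominance

noncomputable section

/-- The heart `r̄_f^B : Γ_K → GL₃(𝔽₃)` of the line `char-zero-dominance` vocabulary has open kernel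
(it is definitionally the heart of the `free-seed-smooth-rt` vocabulary, whose kernel is open by
`FreeSeedSmoothRt.isOpen_ker_rbar`: it factors through the action on the finitely many roots). -/
theorem isOpen_ker_rbar_charZero (f : ℤ[X]) (B : Module.Basis (Fin 3) (ZMod 3) (Heart 3 (Roots f))) :
    IsOpen (((rbar f B).ker : Subgroup (absoluteGaloisGroup K)) : Set (absoluteGaloisGroup K)) :=
  (FreeSeedSmoothRt.pointPlan_small f B).1

/-- The kernel of `r̄_f^B ∘ res_{K → F'} : Γ_{F'} → GL₃(𝔽₃)` is open (preimage of the open kernel of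
the heart under the continuous restriction `Γ_{F'} → Γ_K`). -/
theorem isOpen_ker_rbar_comp_absGaloisRestrict (f : ℤ[X])
    (B : Module.Basis (Fin 3) (ZMod 3) (Heart 3 (Roots f))) (F' : Type) [Field F'] [Algebra K F'] :
    IsOpen ((((rbar f B).comp (absGaloisRestrict K F').toMonoidHom).ker :
      Subgroup (absoluteGaloisGroup F')) : Set (absoluteGaloisGroup F')) :=
  (isOpen_ker_rbar_charZero f B).preimage (absGaloisRestrict K F').continuous

/-- **H9 = G2d** (PA-I glue of `stub_thorneInputOverL`).  If `r̄_f^B ∘ res_{K → F'}` has the image of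
`r̄_f^B`, there is a finite extension `D/F'` (the fixed field of the open kernel of
`r̄_f^B ∘ res_{K → F'}`) such that for every number field `L/F'` with `D ⊗_{F'} L` a field the tower
restriction `r̄_f^B ∘ res_{K → F'} ∘ res_{F' → L}` still has the image of `r̄_f^B`
(G2 `range_comp_absGaloisRestrict_eq_of_isField`, G2b `finiteDimensional_fixedField_ker`). -/
theorem exists_disjointnessField_heart : ∀ (f : ℤ[X]) (ι : PadicAlgCl 3 ≃+* ℂ) (e : K →+* ℂ) (S₀ : Finset (HeightOneSpectrum (𝓞 K))) (ρC : FramedGaloisRep K (PadicAlgCl 3) 3) (𝓕 : OrdFamily f ι e S₀ ρC) (F' : Type) [Field F'] [NumberField F'] [Algebra K F'], ((rbar f 𝓕.B).comp (absGaloisRestrict K F').toMonoidHom).range = (rbar f 𝓕.B).range → ∃ (D : Type) (_ : Field D) (_ : Algebra F' D), FiniteDimensional F' D ∧ ∀ (L : Type) [Field L] [NumberField L] [Algebra F' L], IsField (D ⊗[F'] L) → (((rbar f 𝓕.B).comp (absGaloisRestrict K F').toMonoidHom).comp (absGaloisRestrict F' L).toMonoidHom).range = (rbar f 𝓕.B).range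 := by
  intro f ι e S₀ ρC 𝓕 F' _ _ _ hrange
  have hopen := isOpen_ker_rbar_comp_absGaloisRestrict f 𝓕.B F'
  refine ⟨↥(IntermediateField.fixedField ((rbar f 𝓕.B).comp (absGaloisRestrict K F').toMonoidHom).ker),
    inferInstance, inferInstance,
    finiteDimensional_fixedField_ker F' ((rbar f 𝓕.B).comp (absGaloisRestrict K F').toMonoidHom) hopen,
    fun L _ _ _ hfield => ?_⟩
  rw [range_comp_absGaloisRestrict_eq_of_isField F' L
    ((rbar f 𝓕.B).comp (absGaloisRestrict K F').toMonoidHom) hopen hfield]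
  exact hrange

end

end Summit.Langlands.Langlands.Cruxes.MuOrdinaryFamilyRT.ThorneMinimalLift
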